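import Summits.HodgeConjecture.HodgeConjecture.Theorems.Q8BireflectionGroupDensity
import Literature.Algebra.Lie.SymplecticBireflectionIrreducible
import HarnessLib

/-!
# Route `Q8SymplecticPowers`, crux K1Q — BQ-CORE over `ℂ` and its descent forms WITHOUT Katz's recognition theorems
# (lemma BL is a tree theorem: `Literature.Algebra.Lie.SymplecticBireflection.eq_skewAdjoint_of_isIrreducibleOn_of_conj_mem'`)

Support file for crux K1Q (stmt-HodgeConjecture-24190; `--supports … --as helper`; nothing here closes an item). Prover seat
`hodge-nonav-19716-p2` (g16). The tree's `Q8BireflectionGroupDensity` (prover-Ax g17) proves BQ-CORE — «a quaternionic group with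
STRONGLY irreducible symplectic part and one `(i, −i)`-bireflection has the whole quaternionic-unitary centraliser in the identity
component of its Zariski closure» — CONDITIONALLY on the four named facts `Katz1990_thm14_gabber_of_ne`, `Katz1990_thm14_gabber_dim8`,
`Katz1990_thm15_pseudoreflection`, `Katz1990_rmk141_nonsimple` [Katz, *ESDE*, Ch. 1], which enter ONLY through lemma BL at the Lie level
(`Q8BireflectionLieDensity.eq_skewAdjoint_of_bireflection`). Since then the foundations lane `lit-hodgefound` landed lemma BL
UNCONDITIONALLY and classification-free (`Literature/Algebra/Lie/SymplecticBireflectionIrreducible.lean`: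
`SymplecticBireflection.eq_skewAdjoint_of_isIrreducibleOn_of_conj_mem'` — an irreducible `𝔤 ≤ 𝔰𝔭(M, ω)` stable under `Ad γ` for an
`(i, −i)`-bireflection datum IS `𝔰𝔭(M, ω)`, `dim M ≥ 3`, over any algebraically closed field of characteristic `0`). This file re-runs
the group wrapper of `Q8BireflectionGroupDensity` VERBATIM on that theorem, so that the three statements below are the tree's
`mem_glIdentityComponent_of_bireflection`, `…_baseChange`, `…_baseChange'` with the binders `(h14 …) (h14' …) (h15 …) (h141 …)` deleted and
nothing else changed (the hypothesis `6 ≤ dim M` is kept for drop-in compatibility with the registered stub texts; `3 ≤` would do).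

CONSEQUENCE for the line «mechanism-v2» of K1Q: the print packet S8 no longer needs Katz's Theorem 1.4 (both forms) and Remark 1.4.1
(Theorem 1.5 is itself a tree theorem, `KatzRecognition.Katz1990_thm15_pseudoreflection_holds`) once the transport chain
(`Q8BireflectionGroupDensityAmbient` → `Q8SymplecticPowersTransportRestrictionCurrency` → S7⁺ `stub_transportHeredityQ9`) is re-run on
this file — done in the sibling files `Q8BireflectionGroupDensityAmbientKatzFree` and `Q8SymplecticPowersStubTransportHeredityQ14`.
HONEST FRAMING: algebra only; K1Q ∕ HC ∕ HC_AV are NOT proved here; item 24190 stays OPEN (its geometric inputs (h_sirr), (h_bi) are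
owed by the certificate stubs).

## References
* [Katz1990ESDE] N. M. Katz, *Exponential Sums and Differential Equations*, Ann. of Math. Stud. 124 (1990), Ch. 1, proof of Thm. 1.0
  (the `Ad`-grading device; Thms. 1.4–1.5 and Rmk. 1.4.1 are NOT used).
* [SpringerLAG1998] T. A. Springer, *Linear Algebraic Groups*, 2nd ed. (1998), 2.2.1 (identity component of an algebraic group).
-/

noncomputable section

set_option linter.dupNamespace false

namespace Summit.HodgeConjecture.HodgeConjecture.Theorems.Q8BireflectionGroupDensityKatzFree

open Module Literature.NumberTheory.Automorphic Literature.AlgebraicGeometry.HodgeTheory Literature.AlgebraicGeometry.Motives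
open Literature.Algebra.Lie Literature.Algebra.Lie.KatzRecognition
open Summit.HodgeConjecture.HodgeConjecture.Theorems.Q8CommutatorDegreeTwoCoreTransvections
open Summit.HodgeConjecture.HodgeConjecture.Theorems.Q8QuaternionicTransvectionDensity
open Summit.HodgeConjecture.HodgeConjecture.Theorems.Q8MonodromyLieAlgebra
open Summit.HodgeConjecture.HodgeConjecture.Theorems.Q8BireflectionLieDensity
open LinearMap (BilinForm)
open scoped MatrixGroups Matrix TensorProduct

/-- **BQ-CORE over `ℂ`, UNCONDITIONAL (no Katz named fact).** `V` finite-dimensional complex, `Q` symmetric non-degenerate; `a, b`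
`Q`-isometries, `a² = b² = −1`, `ab = −ba`; `i² = −1`, `dim ker(a − i) ≥ 6`; `Γ ≤ GL(V)` of `Q`-isometries commuting with `a, b`,
STRONGLY irreducible on `M = ker(a − i)` (h_sirr) and containing an `(i, −i)`-bireflection of `(M, Q(·, b ·))` (h_bi). Then every
`Q`-isometry commuting with `a` and `b` lies in `glIdentityComponent Γ`. Same statement as
`Q8BireflectionGroupDensity.mem_glIdentityComponent_of_bireflection` with the binders `h14 h14' h15 h141` DELETED: lemma BL is the tree's
unconditional `SymplecticBireflection.eq_skewAdjoint_of_isIrreducibleOn_of_conj_mem'` (lane `lit-hodgefound`); the group wrapper is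
the verbatim one of the conditional file. K1Q ∕ HC are NOT proved here. [cite: Katz1990ESDE, Ch. 1, proof of Thm. 1.0 (p. 9)]
[cite: SpringerLAG1998, 2.2.1] -/
theorem mem_glIdentityComponent_of_bireflection
    {V : Type} [AddCommGroup V] [Module ℂ V] [FiniteDimensional ℂ V] {Q : BilinForm ℂ V}
    (hQs : ∀ x y, Q x y = Q y x) (hQn : Q.Nondegenerate) {a b : V →ₗ[ℂ] V} (haa : ∀ x, a (a x) = -x)
    (hbb : ∀ x, b (b x) = -x) (hab : ∀ x, a (b x) = -b (a x)) (haQ : ∀ x y, Q (a x) (a y) = Q x y)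
    (hQb : ∀ x y, Q (b x) (b y) = Q x y) {i : ℂ} (hi : i * i = -1) (hM : 6 ≤ finrank ℂ (Module.End.eigenspace a i))
    {Γ : Subgroup (V ≃ₗ[ℂ] V)} (hΓa : ∀ γ ∈ Γ, ∀ x, γ (a x) = a (γ x)) (hΓb : ∀ γ ∈ Γ, ∀ x, γ (b x) = b (γ x))
    (hΓQ : ∀ γ ∈ Γ, ∀ x y, Q (γ x) (γ y) = Q x y)
    (h_sirr : ∀ Γ' : Subgroup (V ≃ₗ[ℂ] V), Γ' ≤ Γ → (Γ'.subgroupOf Γ).FiniteIndex →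
      ∀ F : Submodule ℂ V, F ≤ Module.End.eigenspace a i → (∀ γ ∈ Γ', ∀ x ∈ F, γ x ∈ F) →
      F = ⊥ ∨ F = Module.End.eigenspace a i)
    (h_bi : ∃ γ ∈ Γ, ∃ ℓp ℓm : V, a ℓp = i • ℓp ∧ a ℓm = i • ℓm ∧ Q ℓp (b ℓm) ≠ 0 ∧
      γ ℓp = i • ℓp ∧ γ ℓm = (-i) • ℓm ∧ ∀ x, a x = i • x → Q x (b ℓp) = 0 → Q x (b ℓm) = 0 → γ x = x)
    {g : V ≃ₗ[ℂ] V} (hga : ∀ x, g (a x) = a (g x)) (hgb : ∀ x, g (b x) = b (g x)) (hgQ : ∀ x y, Q (g x) (g y) = Q x y) :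
    g ∈ glIdentityComponent Γ := by
  classical
  -- Mathlib's non-instance commutator bracket on `End`, enabled inside this proof only (no instance attribute in the file)
  letI : LieRing (Module.End ℂ V) := LieRing.ofAssociativeRing
  letI : LieAlgebra ℂ (Module.End ℂ V) := LieAlgebra.ofAssociativeAlgebra
  set Mi : Submodule ℂ V := Module.End.eigenspace a i with hMi
  letI : LieRing (Module.End ℂ Mi) := LieRing.ofAssociativeRing
  letI : LieAlgebra ℂ (Module.End ℂ Mi) := LieAlgebra.ofAssociativeAlgebra
  have hmemMi : ∀ {x : V}, x ∈ Mi ↔ a x = i • x := Module.End.mem_eigenspace_iff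
  -- ### basis, bridge, finite index
  set d := finrank ℂ V with hd
  let bV : Basis (Fin d) ℂ V := Module.finBasis ℂ V
  obtain ⟨Ψ, hΨ⟩ := exists_mulEquiv_coe_eq_toMatrix bV
  rw [mem_glIdentityComponent_iff]
  intro Γ' hΓ'le hfi
  rw [mem_glZariskiClosure_iff_mem_zariskiClosure bV Ψ hΨ Γ' g]
  set Γm : Subgroup (GL (Fin d) ℂ) := Γ.map Ψ.toMonoidHom with hΓm
  set Γm' : Subgroup (GL (Fin d) ℂ) := Γ'.map Ψ.toMonoidHom with hΓm'
  set H' := zariskiClosure Γm' with hH'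
  have hH'alg : IsAlgebraicSubgroup H' := isAlgebraicSubgroup_zariskiClosure Γm'
  have hfi' : (Γm'.subgroupOf Γm).FiniteIndex := by
    refine ⟨?_⟩
    change Γm'.relIndex Γm ≠ 0
    rw [hΓm', hΓm, Subgroup.relIndex_map_map_of_injective Γ' Γ Ψ.injective]
    exact hfi.index_ne_zero
  have hLie : lieAlgebraGL H' = lieAlgebraGL Γm := by
    haveI := hfi'
    rw [hH', lieAlgebraGL_zariskiClosure, lieAlgebraGL_eq_of_finiteIndex (Subgroup.map_mono hΓ'le)]
  -- ### the Lie algebra on `End V`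
  set LV : Submodule ℂ (Module.End ℂ V) := (lieAlgebraGL Γm).comap (LinearMap.toMatrix bV bV).toLinearMap with hLV
  have hmemLV : ∀ Y : Module.End ℂ V, Y ∈ LV ↔ LinearMap.toMatrix bV bV Y ∈ lieAlgebraGL Γm := fun Y => Iff.rfl
  obtain ⟨hbr, hAd⟩ := comap_lieAlgebraGL_bracket_and_conj bV Ψ hΨ Γ
  have hYa : ∀ Y ∈ LV, ∀ x, Y (a x) = a (Y x) := fun Y hY =>
    comm_of_toMatrix_mem_lieAlgebraGL bV Ψ hΨ Γ hΓa ((hmemLV Y).1 hY)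
  have hYb : ∀ Y ∈ LV, ∀ x, Y (b x) = b (Y x) := fun Y hY =>
    comm_of_toMatrix_mem_lieAlgebraGL bV Ψ hΨ Γ hΓb ((hmemLV Y).1 hY)
  have hYQ : ∀ Y ∈ LV, ∀ x y, Q (Y x) y = -Q x (Y y) := fun Y hY =>
    skew_of_toMatrix_mem_lieAlgebraGL bV Ψ hΨ Γ hΓQ ((hmemLV Y).1 hY)
  have hYM : ∀ Y ∈ LV, ∀ m ∈ Mi, Y m ∈ Mi := fun Y hY m hm => by
    rw [hmemMi] at hm ⊢
    rw [← hYa Y hY, hm, map_smul]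
  -- ### the symplectic form on `Mi`
  set ω : BilinForm ℂ Mi := Q.compl₁₂ Mi.subtype (b ∘ₗ Mi.subtype) with hω
  have hωapp : ∀ x y : Mi, ω x y = Q (x : V) (b (y : V)) := fun x y => rfl
  have hωalt : ω.IsAlt := omegaM_isAlt hQs hbb hQb
  have hωn : ω.Nondegenerate := omegaM_nondegenerate hQs hQn haa hbb hab haQ hQb hi
  -- ### the Lie subalgebra `L ≤ End Mi` of restrictions of members of `LV`
  let L : LieSubalgebra ℂ (Module.End ℂ Mi) :=
    { carrier := {Z | ∃ Y ∈ LV, ∀ m : Mi, ((Z m : Mi) : V) = Y m}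
      add_mem' := fun {Z₁ Z₂} h₁ h₂ => by
        obtain ⟨Y₁, hY₁, h₁⟩ := h₁
        obtain ⟨Y₂, hY₂, h₂⟩ := h₂
        exact ⟨Y₁ + Y₂, LV.add_mem hY₁ hY₂, fun m => by
          rw [LinearMap.add_apply, Submodule.coe_add, h₁, h₂, LinearMap.add_apply]⟩
      zero_mem' := ⟨0, LV.zero_mem, fun m => by simp⟩
      smul_mem' := fun c {Z} h => by
        obtain ⟨Y, hY, hZ⟩ := h
        exact ⟨c • Y, LV.smul_mem c hY, fun m => by rw [LinearMap.smul_apply, Submodule.coe_smul, hZ, LinearMap.smul_apply]⟩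
      lie_mem' := fun {Z₁ Z₂} h₁ h₂ => by
        obtain ⟨Y₁, hY₁, h₁⟩ := h₁
        obtain ⟨Y₂, hY₂, h₂⟩ := h₂
        refine ⟨Y₁ * Y₂ - Y₂ * Y₁, hbr Y₁ hY₁ Y₂ hY₂, fun m => ?_⟩
        rw [LieRing.of_associative_ring_bracket, LinearMap.sub_apply, Submodule.coe_sub, Module.End.mul_apply,
          Module.End.mul_apply, h₁ (Z₂ m), h₂ m, h₂ (Z₁ m), h₁ m, LinearMap.sub_apply, Module.End.mul_apply,
          Module.End.mul_apply] }
  have hmemL : ∀ Z : Module.End ℂ Mi, Z ∈ L ↔ ∃ Y ∈ LV, ∀ m : Mi, ((Z m : Mi) : V) = Y m := fun Z => Iff.rfl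
  -- `L ≤ 𝔰𝔭(ω)`
  have hle : L ≤ skewAdjointLieSubalgebra ω := by
    intro Z hZ
    obtain ⟨Y, hY, hZY⟩ := (hmemL Z).1 hZ
    show Z ∈ ω.skewAdjointSubmodule
    rw [LinearMap.mem_skewAdjointSubmodule]
    intro z w
    rw [Pi.neg_apply, map_neg, hωapp, hωapp, hZY z, hZY w, hYQ Y hY, hYb Y hY]
  -- ### the bireflection datum
  obtain ⟨γ, hγΓ, ℓp, ℓm, hℓp, hℓm, hc0, hγp, hγm, hγU⟩ := h_bi
  have hγMi : ∀ x ∈ Mi, γ x ∈ Mi := fun x hx => by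
    rw [hmemMi] at hx ⊢
    rw [← hΓa γ hγΓ, hx, map_smul]
  have hγMi' : ∀ x ∈ Mi, γ.symm x ∈ Mi := fun x hx => by
    rw [hmemMi] at hx ⊢
    apply γ.injective
    rw [hΓa γ hγΓ, LinearEquiv.apply_symm_apply, map_smul, LinearEquiv.apply_symm_apply, hx]
  let γM : Mi ≃ₗ[ℂ] Mi :=
    LinearEquiv.ofLinear ((γ : V →ₗ[ℂ] V).restrict hγMi) ((γ.symm : V →ₗ[ℂ] V).restrict hγMi')
      (LinearMap.ext fun m => Subtype.ext (by simp)) (LinearMap.ext fun m => Subtype.ext (by simp))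
  have hγM : ∀ m : Mi, ((γM m : Mi) : V) = γ m := fun m => rfl
  have hγMs : ∀ m : Mi, ((γM.symm m : Mi) : V) = γ.symm m := fun m => rfl
  -- `Ad γ`-stability of `L`
  have hL : ∀ Z ∈ L, γM.conj Z ∈ L := by
    intro Z hZ
    obtain ⟨Y, hY, hZY⟩ := (hmemL Z).1 hZ
    refine ⟨(γ : Module.End ℂ V) * Y * ((γ⁻¹ : V ≃ₗ[ℂ] V) : Module.End ℂ V), hAd γ hγΓ Y hY, fun m => ?_⟩
    rw [LinearEquiv.conj_apply, LinearMap.comp_apply, LinearMap.comp_apply, LinearEquiv.coe_coe, LinearEquiv.coe_coe, hγM,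
      hZY, hγMs, Module.End.mul_apply, Module.End.mul_apply, LinearEquiv.coe_coe, LinearEquiv.coe_coe]
    rfl
  -- irreducibility of `L` from (h_sirr)
  have hirr : IsIrreducibleOn L := by
    intro W hW
    have key := eq_bot_or_eq_of_lie_stable_of_sirr bV Ψ hΨ Γ Mi h_sirr (W := W.map Mi.subtype)
      (Submodule.map_subtype_le Mi W) (by
        rintro Y hY _ ⟨w, hw, rfl⟩
        have hYLV : Y ∈ LV := hY
        have hZ : (Y.restrict (hYM Y hYLV)) ∈ L := ⟨Y, hYLV, fun m => rfl⟩
        exact ⟨_, hW _ hZ w hw, rfl⟩)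
    rcases key with h0 | h1
    · left
      exact (Submodule.map_injective_of_injective Mi.injective_subtype) (by rw [h0, Submodule.map_bot])
    · right
      exact (Submodule.map_injective_of_injective Mi.injective_subtype) (by rw [h1, Submodule.map_subtype_top])
  -- the datum inside `Mi`
  set c : ℂ := Q ℓp (b ℓm) with hc
  let vp : Mi := ⟨ℓp, hmemMi.2 hℓp⟩
  let vm : Mi := ⟨c⁻¹ • ℓm, Mi.smul_mem _ (hmemMi.2 hℓm)⟩
  have hpm : ω vp vm = 1 := by
    rw [hωapp]
    change Q ℓp (b (c⁻¹ • ℓm)) = 1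
    rw [map_smul, map_smul, smul_eq_mul, ← hc, inv_mul_cancel₀ hc0]
  have hγp' : γM vp = i • vp := Subtype.ext (by rw [hγM, Submodule.coe_smul]; exact hγp)
  have hγm' : γM vm = (-i) • vm :=
    Subtype.ext (by rw [hγM, Submodule.coe_smul]; change γ (c⁻¹ • ℓm) = (-i) • (c⁻¹ • ℓm); rw [map_smul, hγm, smul_comm])
  have hγU' : ∀ x : Mi, ω x vp = 0 → ω x vm = 0 → γM x = x := by
    intro x h1 h2
    apply Subtype.ext
    rw [hγM]
    refine hγU x (hmemMi.1 x.2) h1 ?_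
    rw [hωapp] at h2
    change Q (x : V) (b (c⁻¹ • ℓm)) = 0 at h2
    rw [map_smul, map_smul, smul_eq_mul] at h2
    exact (mul_eq_zero.1 h2).resolve_left (inv_ne_zero hc0)
  -- ### BL, UNCONDITIONAL (tree: `SymplecticBireflection.eq_skewAdjoint_of_isIrreducibleOn_of_conj_mem'`): `L = 𝔰𝔭(Mi, ω)`
  have h3 : 3 ≤ finrank ℂ Mi := le_trans (by norm_num) hM
  have hLsp : L = skewAdjointLieSubalgebra ω :=
    Literature.Algebra.Lie.SymplecticBireflection.eq_skewAdjoint_of_isIrreducibleOn_of_conj_mem' hωn hωalt hi hpm hγp' hγm'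
      hγU' L hle hL hirr h3
  -- ### the quaternionic nilpotents `n_v ∈ LV`
  have hN : ∀ v : V, a v = i • v →
      ((Q.flip (b v)).smulRight v - (Q.flip v).smulRight (b v) : Module.End ℂ V) ∈ LV := by
    intro v hv
    set N : Module.End ℂ V := (Q.flip (b v)).smulRight v - (Q.flip v).smulRight (b v) with hNdef
    have hNapp : ∀ x, N x = Q x (b v) • v - Q x v • b v := fun x => by
      simp [hNdef, LinearMap.sub_apply, LinearMap.smulRight_apply]
    have hNb : ∀ x, N (b x) = b (N x) := by
      intro x
      rw [hNapp, hNapp, map_sub, map_smul, map_smul, hbb, hQb, b_left hQs hbb hQb x v]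
      module
    have hNM : ∀ m ∈ Mi, N m ∈ Mi := by
      intro m hm
      rw [hNapp, eigen_isotropic haQ hi (hmemMi.1 hm) hv, zero_smul, sub_zero]
      exact Mi.smul_mem _ (hmemMi.2 hv)
    have hNres : N.restrict hNM ∈ L := by
      rw [hLsp]
      show N.restrict hNM ∈ ω.skewAdjointSubmodule
      rw [LinearMap.mem_skewAdjointSubmodule]
      intro z w
      rw [Pi.neg_apply, map_neg, hωapp, hωapp, LinearMap.coe_restrict_apply, LinearMap.coe_restrict_apply, hNapp, hNapp,
        eigen_isotropic haQ hi (hmemMi.1 z.2) hv, eigen_isotropic haQ hi (hmemMi.1 w.2) hv]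
      simp only [zero_smul, sub_zero, map_smul, LinearMap.smul_apply, smul_eq_mul]
      rw [b_skew hQs hbb hQb v (w : V)]
      ring
    obtain ⟨Y, hY, hYN⟩ := (hmemL _).1 hNres
    have hYN' : Y = N := by
      refine sub_eq_zero.1 (eq_zero_of_comm_b_of_forall_mem haa hbb hab hi (f := Y - N) (fun x => ?_) (fun m hm => ?_))
      · simp only [LinearMap.sub_apply, map_sub, hYb Y hY x, hNb x]
      · have := hYN ⟨m, hmemMi.2 hm⟩
        rw [LinearMap.coe_restrict_apply] at this
        rw [LinearMap.sub_apply, ← this, sub_self]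
    rw [← hYN']
    exact hY
  -- ### the quaternionic transvections along `Mi ∖ {0}` lie in `(Γ')^Zar`; Lemma T; `((Γ')^Zar)^Zar = (Γ')^Zar`
  have hT : ∀ v ∈ {v : V | a v = i • v ∧ v ≠ 0}, ∃ l : ℂ, l ≠ 0 ∧ ∃ T ∈ glZariskiClosureSubgroup Γ',
      ∀ x, T x = x + (l * Q x (b v)) • v + (-(l * Q x v)) • b v := by
    rintro v ⟨hv, -⟩
    obtain ⟨T, hT⟩ := exists_qtransvection_equiv hQs haQ hbb hQb hi hv (1 : ℂ)
    refine ⟨1, one_ne_zero, T, ?_, hT⟩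
    rw [mem_glZariskiClosureSubgroup_iff, mem_glZariskiClosure_iff_mem_zariskiClosure bV Ψ hΨ Γ' T]
    set N : Module.End ℂ V := (Q.flip (b v)).smulRight v - (Q.flip v).smulRight (b v) with hNdef
    have hNapp : ∀ x, N x = Q x (b v) • v - Q x v • b v := fun x => by
      simp [hNdef, LinearMap.sub_apply, LinearMap.smulRight_apply]
    have hA : LinearMap.toMatrix bV bV N ∈ lieAlgebraGL H' := by
      rw [hLie]
      exact (hmemLV N).1 (hN v hv)
    have hN2 : N * N = 0 := by
      obtain ⟨h1, h2, h3, h4⟩ := table_v hQs haQ hbb hQb hi hv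
      refine LinearMap.ext fun x => ?_
      rw [Module.End.mul_apply, hNapp (N x), hNapp x, LinearMap.zero_apply]
      simp only [map_sub, map_smul, LinearMap.sub_apply, LinearMap.smul_apply, smul_eq_mul, h1, h2, h3, h4, mul_zero,
        sub_zero, zero_smul]
    have hsq : LinearMap.toMatrix bV bV N ^ 2 = 0 := by rw [pow_two, ← LinearMap.toMatrix_mul, hN2, map_zero]
    have hnil : IsNilpotent (LinearMap.toMatrix bV bV N) := ⟨2, hsq⟩
    have hmem := expHom_mem_of_mem_lieAlgebraGL hH'alg hA hnil (Multiplicative.ofAdd (1 : ℂ))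
    have hcoe : ((expHom _ hnil (Multiplicative.ofAdd (1 : ℂ)) : GL (Fin d) ℂ) : Matrix (Fin d) (Fin d) ℂ) =
        1 + LinearMap.toMatrix bV bV N := by
      rw [coe_expHom_apply, toAdd_ofAdd, exp_smul_matrix_eq_sum hsq]
      simp [Finset.sum_range_succ]
    have hTN : (T : V →ₗ[ℂ] V) = 1 + N := by
      refine LinearMap.ext fun x => ?_
      rw [LinearEquiv.coe_coe, hT x, LinearMap.add_apply, Module.End.one_apply, hNapp]
      module
    have hTmat : ((Ψ T : GL (Fin d) ℂ) : Matrix (Fin d) (Fin d) ℂ) = 1 + LinearMap.toMatrix bV bV N := by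
      rw [hΨ, hTN, map_add, LinearMap.toMatrix_one]
    have heq : Ψ T = expHom _ hnil (Multiplicative.ofAdd (1 : ℂ)) := Units.ext (by rw [hTmat, hcoe])
    rw [heq]
    exact hmem
  have hspan : ∀ m, a m = i • m → m ∈ Submodule.span ℂ {v : V | a v = i • v ∧ v ≠ 0} := fun m hm => by
    by_cases hm0 : m = 0
    · rw [hm0]; exact Submodule.zero_mem _
    · exact Submodule.subset_span ⟨hm, hm0⟩
  have hg' := mem_glZariskiClosure_of_quaternionic hQs hQn haa hbb hab haQ hQb hi (R := {v : V | a v = i • v ∧ v ≠ 0})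
    (fun v hv => hv.1) hspan (sirr_conn hQs hQn haa hbb hab haQ hQb hi) hT hga hgb hgQ
  rw [mem_glZariskiClosure_iff_mem_zariskiClosure bV Ψ hΨ _ g, map_glZariskiClosureSubgroup_eq_zariskiClosure bV Ψ hΨ,
    ← hΓm', ← hH', hH'alg.zariskiClosure_eq] at hg'
  exact hg'

/-- **BQ-CORE over a subfield `K ⊆ ℂ` (descent form, the currency of the K1Q kernel `q8Comm_of_glIdentityComponent_subset_…`).**
`V`, `Q`, `a`, `b`, `Γ ≤ GL_K(V)` over a field `K` of characteristic `0` with `K → ℂ`; the hypotheses (h_sirr), (h_bi) and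
`dim M ≥ 6` are stated for the base change to `ℂ` (`M = ker(a_ℂ − i)`, the group `Γ_ℂ = Γ.map glBaseChangeHom`, the bireflection
the base change of some `γ ∈ Γ`). Then every `Q`-isometry of `V` commuting with `a, b` lies in `glIdentityComponent Γ` over `K`:
`mem_glIdentityComponent_of_bireflection` for `Γ_ℂ` and descent (`mem_glIdentityComponent_of_baseChange`). UNCONDITIONAL (no Katz
named fact); K1Q ∕ HC are NOT proved here. [cite: SpringerLAG1998, 2.2.1] -/
theorem mem_glIdentityComponent_of_bireflection_baseChange
    {K : Type} [Field K] [Algebra K ℂ] {V : Type} [AddCommGroup V] [Module K V] [FiniteDimensional K V]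
    {Q : BilinForm K V} (hQs : ∀ x y, Q x y = Q y x) (hQn : Q.Nondegenerate) {a b : V →ₗ[K] V} (haa : ∀ x, a (a x) = -x)
    (hbb : ∀ x, b (b x) = -x) (hab : ∀ x, a (b x) = -b (a x)) (haQ : ∀ x y, Q (a x) (a y) = Q x y)
    (hQb : ∀ x y, Q (b x) (b y) = Q x y) {i : ℂ} (hi : i * i = -1)
    (hM : 6 ≤ finrank ℂ (Module.End.eigenspace (a.baseChange ℂ) i))
    {Γ : Subgroup (V ≃ₗ[K] V)} (hΓa : ∀ γ ∈ Γ, ∀ x, γ (a x) = a (γ x)) (hΓb : ∀ γ ∈ Γ, ∀ x, γ (b x) = b (γ x))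
    (hΓQ : ∀ γ ∈ Γ, ∀ x y, Q (γ x) (γ y) = Q x y)
    (h_sirr : ∀ Δ' : Subgroup (ℂ ⊗[K] V ≃ₗ[ℂ] ℂ ⊗[K] V), Δ' ≤ Γ.map (glBaseChangeHom K ℂ V) →
      (Δ'.subgroupOf (Γ.map (glBaseChangeHom K ℂ V))).FiniteIndex →
      ∀ F : Submodule ℂ (ℂ ⊗[K] V), F ≤ Module.End.eigenspace (a.baseChange ℂ) i → (∀ γ ∈ Δ', ∀ x ∈ F, γ x ∈ F) →
      F = ⊥ ∨ F = Module.End.eigenspace (a.baseChange ℂ) i)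
    (h_bi : ∃ γ ∈ Γ, ∃ ℓp ℓm : ℂ ⊗[K] V, a.baseChange ℂ ℓp = i • ℓp ∧ a.baseChange ℂ ℓm = i • ℓm ∧
      Q.baseChange ℂ ℓp (b.baseChange ℂ ℓm) ≠ 0 ∧ glBaseChangeHom K ℂ V γ ℓp = i • ℓp ∧
      glBaseChangeHom K ℂ V γ ℓm = (-i) • ℓm ∧
      ∀ x, a.baseChange ℂ x = i • x → Q.baseChange ℂ x (b.baseChange ℂ ℓp) = 0 → Q.baseChange ℂ x (b.baseChange ℂ ℓm) = 0 →
        glBaseChangeHom K ℂ V γ x = x)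
    {g : V ≃ₗ[K] V} (hga : ∀ x, g (a x) = a (g x)) (hgb : ∀ x, g (b x) = b (g x)) (hgQ : ∀ x y, Q (g x) (g y) = Q x y) :
    g ∈ glIdentityComponent Γ := by
  refine mem_glIdentityComponent_of_baseChange (L := ℂ) ?_
  have hgL : ∀ (h : V ≃ₗ[K] V) (x : ℂ ⊗[K] V), glBaseChangeHom K ℂ V h x = (h : V →ₗ[K] V).baseChange ℂ x := fun h x => rfl
  obtain ⟨γ, hγ, ℓp, ℓm, h1, h2, h3, h4, h5, h6⟩ := h_bi
  refine mem_glIdentityComponent_of_bireflection (V := ℂ ⊗[K] V) (Q := Q.baseChange ℂ)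
    (a := a.baseChange ℂ) (b := b.baseChange ℂ) (i := i) (baseChange_symm hQs)
    (Literature.Algebra.Lie.KillingBaseChange.nondegenerate_baseChange hQn) (baseChange_sq_neg haa) (baseChange_sq_neg hbb)
    (baseChange_anticomm hab) (baseChange_isometry haQ) (baseChange_isometry hQb) hi hM
    (Γ := Γ.map (glBaseChangeHom K ℂ V)) ?_ ?_ ?_ h_sirr
    ⟨glBaseChangeHom K ℂ V γ, Subgroup.mem_map_of_mem _ hγ, ℓp, ℓm, h1, h2, h3, h4, h5, h6⟩ ?_ ?_ ?_
  · rintro _ ⟨δ, hδ, rfl⟩ x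
    change glBaseChangeHom K ℂ V δ _ = _
    rw [hgL, hgL]
    exact baseChange_comm_apply (f := (δ : V →ₗ[K] V)) (g := a) (hΓa δ hδ) x
  · rintro _ ⟨δ, hδ, rfl⟩ x
    change glBaseChangeHom K ℂ V δ _ = _
    rw [hgL, hgL]
    exact baseChange_comm_apply (f := (δ : V →ₗ[K] V)) (g := b) (hΓb δ hδ) x
  · rintro _ ⟨δ, hδ, rfl⟩ x y
    change Q.baseChange ℂ (glBaseChangeHom K ℂ V δ x) (glBaseChangeHom K ℂ V δ y) = _
    rw [hgL, hgL]
    exact baseChange_isometry (f := (δ : V →ₗ[K] V)) (hΓQ δ hδ) x y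
  · intro x
    rw [hgL, hgL]
    exact baseChange_comm_apply (f := (g : V →ₗ[K] V)) (g := a) hga x
  · intro x
    rw [hgL, hgL]
    exact baseChange_comm_apply (f := (g : V →ₗ[K] V)) (g := b) hgb x
  · intro x y
    rw [hgL, hgL]
    exact baseChange_isometry (f := (g : V →ₗ[K] V)) hgQ x y

/-- **BQ-CORE, descent form with STRONG irreducibility quantified over the RATIONAL finite-index subgroups** (the currency of the
K1Q skeleton «mechanism-v2», stub S4 (iii): `Γ' ≤ Γ` of finite index acting on `ℂ ⊗ V` through `γ ↦ (γ : V →ₗ V).baseChange ℂ`).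
Same conclusion as `mem_glIdentityComponent_of_bireflection_baseChange`; the finite-index subgroups of `Γ_ℂ = Γ.map glBaseChangeHom` are
pulled back to finite-index subgroups of `Γ` (index bookkeeping through the surjection `Γ → Γ_ℂ`). UNCONDITIONAL (no Katz named
fact); K1Q ∕ HC are NOT proved here. [cite: SpringerLAG1998, 2.2.1] -/
theorem mem_glIdentityComponent_of_bireflection_baseChange'
    {K : Type} [Field K] [Algebra K ℂ] {V : Type} [AddCommGroup V] [Module K V] [FiniteDimensional K V]
    {Q : BilinForm K V} (hQs : ∀ x y, Q x y = Q y x) (hQn : Q.Nondegenerate) {a b : V →ₗ[K] V} (haa : ∀ x, a (a x) = -x)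
    (hbb : ∀ x, b (b x) = -x) (hab : ∀ x, a (b x) = -b (a x)) (haQ : ∀ x y, Q (a x) (a y) = Q x y)
    (hQb : ∀ x y, Q (b x) (b y) = Q x y) {i : ℂ} (hi : i * i = -1)
    (hM : 6 ≤ finrank ℂ (Module.End.eigenspace (a.baseChange ℂ) i))
    {Γ : Subgroup (V ≃ₗ[K] V)} (hΓa : ∀ γ ∈ Γ, ∀ x, γ (a x) = a (γ x)) (hΓb : ∀ γ ∈ Γ, ∀ x, γ (b x) = b (γ x))
    (hΓQ : ∀ γ ∈ Γ, ∀ x y, Q (γ x) (γ y) = Q x y)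
    (h_sirr : ∀ Γ' : Subgroup (V ≃ₗ[K] V), Γ' ≤ Γ → (Γ'.subgroupOf Γ).FiniteIndex →
      ∀ F : Submodule ℂ (ℂ ⊗[K] V), F ≤ Module.End.eigenspace (a.baseChange ℂ) i →
      (∀ γ ∈ Γ', ∀ x ∈ F, (γ : V →ₗ[K] V).baseChange ℂ x ∈ F) → F = ⊥ ∨ F = Module.End.eigenspace (a.baseChange ℂ) i)
    (h_bi : ∃ γ ∈ Γ, ∃ ℓp ℓm : ℂ ⊗[K] V, a.baseChange ℂ ℓp = i • ℓp ∧ a.baseChange ℂ ℓm = i • ℓm ∧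
      Q.baseChange ℂ ℓp (b.baseChange ℂ ℓm) ≠ 0 ∧ (γ : V →ₗ[K] V).baseChange ℂ ℓp = i • ℓp ∧
      (γ : V →ₗ[K] V).baseChange ℂ ℓm = (-i) • ℓm ∧
      ∀ x, a.baseChange ℂ x = i • x → Q.baseChange ℂ x (b.baseChange ℂ ℓp) = 0 → Q.baseChange ℂ x (b.baseChange ℂ ℓm) = 0 →
        (γ : V →ₗ[K] V).baseChange ℂ x = x)
    {g : V ≃ₗ[K] V} (hga : ∀ x, g (a x) = a (g x)) (hgb : ∀ x, g (b x) = b (g x)) (hgQ : ∀ x y, Q (g x) (g y) = Q x y) :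
    g ∈ glIdentityComponent Γ := by
  have hgL : ∀ (h : V ≃ₗ[K] V) (x : ℂ ⊗[K] V), glBaseChangeHom K ℂ V h x = (h : V →ₗ[K] V).baseChange ℂ x := fun h x => rfl
  refine mem_glIdentityComponent_of_bireflection_baseChange hQs hQn haa hbb hab haQ hQb hi hM hΓa hΓb hΓQ ?_ ?_ hga hgb hgQ
  · intro Δ' hΔ' hfi F hFM hF
    -- pull `Δ'` back to `Γ' = φ⁻¹(Δ') ∩ Γ`, of finite index in `Γ`
    set φ := glBaseChangeHom K ℂ V with hφ
    set Γ' : Subgroup (V ≃ₗ[K] V) := Δ'.comap φ ⊓ Γ with hΓ'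
    have hfi' : (Γ'.subgroupOf Γ).FiniteIndex := by
      let ρ : Γ →* (Γ.map φ) := (φ.restrict Γ).codRestrict _ fun x => Subgroup.mem_map_of_mem _ x.2
      have hρ : Function.Surjective ρ := by
        rintro ⟨_, hy⟩
        obtain ⟨δ, hδ, rfl⟩ := Subgroup.mem_map.1 hy
        exact ⟨⟨δ, hδ⟩, rfl⟩
      have hcomap : (Δ'.subgroupOf (Γ.map φ)).comap ρ = Γ'.subgroupOf Γ := by
        ext x
        simp only [Subgroup.mem_comap, Subgroup.mem_subgroupOf, hΓ', Subgroup.mem_inf, SetLike.coe_mem, and_true]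
        rfl
      refine ⟨?_⟩
      rw [← hcomap, Subgroup.index_comap_of_surjective _ hρ]
      exact hfi.index_ne_zero
    refine h_sirr Γ' (by rw [hΓ']; exact inf_le_right) hfi' F hFM fun γ hγ x hx => ?_
    have hγ' : φ γ ∈ Δ' := (Subgroup.mem_inf.1 hγ).1
    rw [← hgL]
    exact hF _ hγ' x hx
  · obtain ⟨γ, hγ, ℓp, ℓm, h1, h2, h3, h4, h5, h6⟩ := h_bi
    exact ⟨γ, hγ, ℓp, ℓm, h1, h2, h3, by rw [hgL]; exact h4, by rw [hgL]; exact h5, fun x hx hp hm => by rw [hgL]; exact h6 x hx hp hm⟩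

end Summit.HodgeConjecture.HodgeConjecture.Theorems.Q8BireflectionGroupDensityKatzFree

end
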